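import Summits.BirchSwinnertonDyer.BirchSwinnertonDyer.Theorems.SylvesterTwoHeegnerIndexCoupledTelescopeTowerTrace
import Summits.BirchSwinnertonDyer.BirchSwinnertonDyer.Theorems.SylvesterTwoHeegnerIndexCMFlipLayerL1Prep
import HarnessLib

/-!
# The COUPLED Cassels–Tate telescope, XXXI: Gross's Prop. 3.6 for `j = 0` ALONG A LIST of Kolyvagin derivative
# operators — the invariance input of the (T-L1) class term at a general squarefree conductor (RESIDUE c v3)

Crux `UpperOffV0HSYPlus` (stmt-BirchSwinnertonDyer-19804).  The (T-L1) class term `c_X(n)`, `n = q₁⋯q_s ∈ KolSupp`,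
is the recipe class (k-ty1 SPEC §5 (R0) `HuShuYin2019.exists_cmFrame_kolyvaginClass`) of `P_n = κ⁻¹ ι(D_n y_n)`,
`D_n = D_{q₁} ∘ ⋯ ∘ D_{q_s}`; its invariance input (R5) `hP` is Gross 1991 Prop. 3.6: every generator `σ_q` of
`Gal(K[9pn]/K[9p]) = ∏ G_q` moves `D_n y_n` into `2^M E(K[9pn])`.  For the `j = 0` curve `W₀` ALL the traces
vanish (`a_q(W₀) = 0` at every Kolyvagin prime `q ≡ 2 (3)`: (T10) `sum_pointGalHom_pow_eq_zero_sylvesterTower`), so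
Prop. 3.6 holds in the EXACT form `σ_q (D_n y_n) − D_n y_n = (q + 1) • D_{n/q} y_n` — pure group-ring algebra in a
fixed level field `L`, which this file records for a LIST `l` of pairs `(σ, q)` (pairwise commuting — Gross §3: the
`G_q` commute in the abelian `Gal(K[n]/K)`), `D_l y := l.foldr (fun a z ↦ D_{a.1, a.2} z) y`:
* `pointGalHom_foldr_derivOp_comm` — an automorphism commuting with the list commutes with `D_l`;
* `sum_pointGalHom_pow_foldr_derivOp_eq_zero` — `Σ_{i ≤ q} τ^i y = 0 ⟹ Σ_{i ≤ q} τ^i (D_l y) = 0` ((T10) iterated);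
* `foldr_derivOp_perm` — `D_l y = D_{l'} y` for `l ~ l'` (bring any prime to the front; `derivOp_derivOp_comm`);
* ★ `pointGalHom_derivOp_foldr_sub_eq` — the HEAD form of Prop. 3.6: `σ (D_σ (D_l y)) − D_σ (D_l y) = (q+1) • D_l y`
  when `σ^{q+1} = 1`, `Σ_{i ≤ q} σ^i y = 0` and `σ` commutes with the list (`pointGalHom_derivOp_sub_eq_of_trace_eq_zero`);
* ★ `pointGalHom_foldr_derivOp_sub_eq_of_mem` — the same for ANY member `(σ, q) ∈ l` of a pairwise-commuting list
  (first occurrence erased): `σ (D_l y) − D_l y = (q+1) • D_{l.erase (σ,q)} y`;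
* `smul_sub_mem_of_mem_closure`, ★ `exists_smul_eq_smul_sub_of_mem_closure` — from the generators `σ_q` (and `N`) to the
  group they generate: the recipe's (R5) `hP : ∀ h, ∃ a ∈ A, 2^M • a = h • P − P` from the per-generator identities.
Theorems only (no definition / named fact / instance / notation); nothing asserted on 19804; no stub closed;
X12.CMAtTwo NOT proved; BSD not claimed for any curve.  Sources: [GrossLMS1991] §3 (3.4)–(3.5), Prop. 3.6 (proof,
p. 239–240); [McCallumLMS1991] §4 (4); [HuShuYin2019] §4.1.  `lean search 'foldr_derivOp'` → nothing before this file.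
-/

set_option linter.dupNamespace false -- Summits modules are `Summit.<Summit>.<Problem>…` by design
set_option autoImplicit false

noncomputable section

open scoped Classical

namespace Summit.BirchSwinnertonDyer.BirchSwinnertonDyer.Theorems.SylvesterTwoCMFlip

open WeierstrassCurve Finset
open Literature.NumberTheory.EllipticCurves

variable (W : WeierstrassCurve ℚ) {L : Type} [Field L] [CharZero L] [DecidableEq L]

/-- An automorphism commuting with every `σ` of the list commutes with `D_l`. [cite: GrossLMS1991, §3 (p. 239)] -/
theorem pointGalHom_foldr_derivOp_comm {τ : L ≃ₐ[ℚ] L} (l : List ((L ≃ₐ[ℚ] L) × ℕ))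
    (hc : ∀ a ∈ l, Commute τ a.1) (y : (W.baseChange L).toAffine.Point) :
    pointGalHom W L τ (l.foldr (fun a z ↦ KolyvaginOperator.derivOp (pointGalHom W L) a.1 a.2 z) y) =
      l.foldr (fun a z ↦ KolyvaginOperator.derivOp (pointGalHom W L) a.1 a.2 z) (pointGalHom W L τ y) := by
  induction l with
  | nil => rfl
  | cons a l ih =>
    rw [List.foldr_cons, List.foldr_cons,
      pointGalHom_derivOp_comm W (hc a (List.mem_cons_self)) a.2, ih (fun b hb ↦ hc b (List.mem_cons_of_mem a hb))]

/-- `Σ_{i ≤ q} τ^i y = 0 ⟹ Σ_{i ≤ q} τ^i (D_l y) = 0` for `τ` commuting with the list ((T10)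
`sum_pointGalHom_pow_derivOp_eq_zero` iterated). [cite: GrossLMS1991, §3 (3.5), Prop. 3.7 (1)] -/
theorem sum_pointGalHom_pow_foldr_derivOp_eq_zero {τ : L ≃ₐ[ℚ] L} (l : List ((L ≃ₐ[ℚ] L) × ℕ))
    (hc : ∀ a ∈ l, Commute τ a.1) {q : ℕ} {y : (W.baseChange L).toAffine.Point}
    (hy : ∑ i ∈ Finset.range (q + 1), pointGalHom W L (τ ^ i) y = 0) :
    ∑ i ∈ Finset.range (q + 1), pointGalHom W L (τ ^ i)
      (l.foldr (fun a z ↦ KolyvaginOperator.derivOp (pointGalHom W L) a.1 a.2 z) y) = 0 := by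
  induction l with
  | nil => exact hy
  | cons a l ih =>
    rw [List.foldr_cons]
    exact sum_pointGalHom_pow_derivOp_eq_zero W (hc a (List.mem_cons_self)) a.2
      (ih (fun b hb ↦ hc b (List.mem_cons_of_mem a hb)))

/-- `D_l y = D_{l'} y` for a permutation `l ~ l'` of a pairwise-commuting list (`D_σ D_{σ'} = D_{σ'} D_σ`,
`derivOp_derivOp_comm`; Gross §3: `D_n = ∏ D_ℓ` in the commutative group ring). [cite: GrossLMS1991, §3 (3.5)] -/
theorem foldr_derivOp_perm {l l' : List ((L ≃ₐ[ℚ] L) × ℕ)} (hp : l.Perm l')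
    (hc : ∀ a ∈ l, ∀ b ∈ l, Commute a.1 b.1) (y : (W.baseChange L).toAffine.Point) :
    l.foldr (fun a z ↦ KolyvaginOperator.derivOp (pointGalHom W L) a.1 a.2 z) y =
      l'.foldr (fun a z ↦ KolyvaginOperator.derivOp (pointGalHom W L) a.1 a.2 z) y :=
  hp.foldr_eq' (fun a ha b hb z ↦ derivOp_derivOp_comm W (hc b hb a ha) b.2 a.2 z) y

/-- ★ **Gross's Prop. 3.6 for `j = 0`, head form**: for `σ` of order dividing `q + 1` commuting with the list and
`Σ_{i ≤ q} σ^i y = 0` (`a_q = 0`), `σ (D_σ (D_l y)) − D_σ (D_l y) = (q + 1) • D_l y` EXACTLY.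
[cite: GrossLMS1991, Prop. 3.6 (proof: (σ_ℓ − 1) D_ℓ = ℓ + 1 − Tr_ℓ)] [cite: McCallumLMS1991, §4 (4)] -/
theorem pointGalHom_derivOp_foldr_sub_eq {σ : L ≃ₐ[ℚ] L} {q : ℕ} (hσ : σ ^ (q + 1) = 1)
    (l : List ((L ≃ₐ[ℚ] L) × ℕ)) (hc : ∀ a ∈ l, Commute σ a.1) {y : (W.baseChange L).toAffine.Point}
    (hy : ∑ i ∈ Finset.range (q + 1), pointGalHom W L (σ ^ i) y = 0) :
    pointGalHom W L σ (KolyvaginOperator.derivOp (pointGalHom W L) σ q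
        (l.foldr (fun a z ↦ KolyvaginOperator.derivOp (pointGalHom W L) a.1 a.2 z) y)) -
      KolyvaginOperator.derivOp (pointGalHom W L) σ q
        (l.foldr (fun a z ↦ KolyvaginOperator.derivOp (pointGalHom W L) a.1 a.2 z) y) =
      ((q + 1 : ℕ) : ℤ) • l.foldr (fun a z ↦ KolyvaginOperator.derivOp (pointGalHom W L) a.1 a.2 z) y :=
  pointGalHom_derivOp_sub_eq_of_trace_eq_zero W hσ (sum_pointGalHom_pow_foldr_derivOp_eq_zero W l hc hy)

/-- ★ **Gross's Prop. 3.6 for `j = 0`, any member**: for a pairwise-commuting list `l` and a member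
`(σ, q) ∈ l` with `σ^{q+1} = 1`, `Σ_{i ≤ q} σ^i y = 0`: `σ (D_l y) − D_l y = (q + 1) • D_{l.erase (σ, q)} y`
(bring `(σ, q)` to the front by `foldr_derivOp_perm`, then the head form).  With `2^M ∣ q + 1` for every member this
is the invariance (R5) of `D_n y_n` modulo `2^M`. [cite: GrossLMS1991, Prop. 3.6] [cite: McCallumLMS1991, §4 (4)] -/
theorem pointGalHom_foldr_derivOp_sub_eq_of_mem {l : List ((L ≃ₐ[ℚ] L) × ℕ)}
    (hc : ∀ a ∈ l, ∀ b ∈ l, Commute a.1 b.1) {a : (L ≃ₐ[ℚ] L) × ℕ} (ha : a ∈ l)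
    (hσ : a.1 ^ (a.2 + 1) = 1) {y : (W.baseChange L).toAffine.Point}
    (hy : ∑ i ∈ Finset.range (a.2 + 1), pointGalHom W L (a.1 ^ i) y = 0) :
    pointGalHom W L a.1 (l.foldr (fun b z ↦ KolyvaginOperator.derivOp (pointGalHom W L) b.1 b.2 z) y) -
      l.foldr (fun b z ↦ KolyvaginOperator.derivOp (pointGalHom W L) b.1 b.2 z) y =
      ((a.2 + 1 : ℕ) : ℤ) • (l.erase a).foldr (fun b z ↦ KolyvaginOperator.derivOp (pointGalHom W L) b.1 b.2 z) y := by
  have hperm : l.Perm (a :: l.erase a) := List.perm_cons_erase ha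
  rw [foldr_derivOp_perm W hperm hc y, List.foldr_cons]
  have hsub : ∀ b ∈ l.erase a, b ∈ l := fun b hb ↦ List.mem_of_mem_erase hb
  exact pointGalHom_derivOp_foldr_sub_eq W hσ (l.erase a) (fun b hb ↦ hc a ha b (hsub b hb)) hy


/-! ### From the generators to the group they generate (Gross Prop. 3.6: "the class of `P_n` is fixed by `𝒢_n`") -/

/-- **`g • x − x ∈ B` for every `g` in the subgroup generated by `S`, once it holds for `s ∈ S`** (`B` a
`G`-stable subgroup): `(gh − 1) = g(h − 1) + (g − 1)`, `(g⁻¹ − 1) = −g⁻¹(g − 1)`.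
[cite: GrossLMS1991, Prop. 3.6 (proof: "it suffices to check this for σ = σ_ℓ")] -/
theorem smul_sub_mem_of_mem_closure {G X : Type*} [Group G] [AddCommGroup X] [DistribMulAction G X]
    (B : AddSubgroup X) (hB : ∀ (g : G), ∀ b ∈ B, g • b ∈ B) {S : Set G} {x : X}
    (hS : ∀ s ∈ S, s • x - x ∈ B) {g : G} (hg : g ∈ Subgroup.closure S) : g • x - x ∈ B := by
  induction hg using Subgroup.closure_induction with
  | mem s hs => exact hS s hs
  | one => rw [one_smul, sub_self]; exact B.zero_mem
  | mul g h _ _ ihg ihh =>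
    have e : (g * h) • x - x = g • (h • x - x) + (g • x - x) := by rw [mul_smul, smul_sub]; abel
    rw [e]
    exact B.add_mem (hB g _ ihh) ihg
  | inv g _ ih =>
    have e : g⁻¹ • x - x = -(g⁻¹ • (g • x - x)) := by rw [smul_sub, inv_smul_smul]; abel
    rw [e]
    exact B.neg_mem (hB g⁻¹ _ ih)

/-- **The recipe's invariance input (R5) from the generators**: if `A` is a `G`-stable subgroup and for every
generator `s ∈ S` there is `a ∈ A` with `n • a = s • x − x`, then the same holds for every `g ∈ ⟨S⟩`
(`B := n • A` is `G`-stable).  Used with `S = {lifts of the σ_q} ∪ N`, `A = E₉(K̄)^N`, `n = 2^M`, `x = P_n`.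
[cite: GrossLMS1991, Prop. 3.6] [cite: McCallumLMS1991, §4 (4)] -/
theorem exists_smul_eq_smul_sub_of_mem_closure {G X : Type*} [Group G] [AddCommGroup X] [DistribMulAction G X]
    (A : AddSubgroup X) (hA : ∀ (g : G), ∀ a ∈ A, g • a ∈ A) (n : ℤ) {S : Set G} {x : X}
    (hS : ∀ s ∈ S, ∃ a ∈ A, n • a = s • x - x) {g : G} (hg : g ∈ Subgroup.closure S) :
    ∃ a ∈ A, n • a = g • x - x := by
  have key := smul_sub_mem_of_mem_closure (A.map (zsmulAddGroupHom n : X →+ X))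
    (fun g' b hb ↦ by
      obtain ⟨a, ha, rfl⟩ := hb
      refine ⟨g' • a, hA g' a ha, ?_⟩
      change n • (g' • a) = g' • (n • a)
      exact smul_comm n g' a)
    (fun s hs ↦ by
      obtain ⟨a, ha, e⟩ := hS s hs
      exact ⟨a, ha, e⟩) hg
  obtain ⟨a, ha, e⟩ := key
  exact ⟨a, ha, e⟩

end Summit.BirchSwinnertonDyer.BirchSwinnertonDyer.Theorems.SylvesterTwoCMFlip

end
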